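import Literature.NumberTheory.Sieve.FordMaynardTypeIBound
import Literature.NumberTheory.Sieve.DivisorPowerSums
import Literature.Barriers.Parity.FordMaynardPrimeSieves
import HarnessLib

/-!
# Ford–Maynard, Theorem 6.3 (a) in exact form: prime-free admissible sequences from `h`

Last file of the arithmetic half of Theorem 6.3 (a) / Theorem 9.1 of K. Ford, J. Maynard, *On the
theory of prime producing sieves* (arXiv:2407.14368). Everything here is PROVED. Given a function
`h ∈ 𝒮` on vectors which is bounded, supported on vectors with entries `≥ η`, piecewise Lipschitz in
each dimension, vanishing in large dimensions and on the empty vector, satisfying (TypeI-f) with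
parameter `γ`, and VANISHING at every vector with a nonempty proper subsum in
`[γ − ε, γ + ε] ∪ [θ − ε, θ + ν + ε]`, the sequence `w_n = h(𝐯(n)) μ²(n)` of §6.2 satisfies, for
every `B > 0` and all large `x`:

* the Type-I bound (I) at level `x^γ` (`typeI_wseq`, from `exists_Vsum_bound` and the divisor
  moment `∑_{m ≤ x} τ(m)^b/m ≪ (log x)^{2^{b+1}}` of the tree);
* the Type-II bound (II) in the range `[θ, θ + ν]` trivially — every term vanishes
  (`typeII_of_forall_eq_zero`, `wseq_mul_eq_zero_of_typeII_range`); this uses vanishing on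
  subsums in `[θ − ε, θ)` as well (divisors `m` with `(x/2)^θ < m < n^θ`), a point passed over in
  the printed proof ("all of the divisors of `n` are either `< n^θ ≤ x^θ` or …", §6.2);

and if moreover `z = h(1) < −1 ≤ h` in dimensions `≥ 2` (up to the factor `z`: `z ≤ h`), then
`a_n = 1 − w_n/z` is a bounded non-negative sequence with `a_p = 0` on primes whose `a − 1`
satisfies (I) and (II): `FordMaynard.PrimeFreeAdmissible γ θ ν B` for every `B > 0`
(`primeFreeAdmissible_of_vecFn`) — the conclusion shape of Theorems 2.1/9.1. The analytic half
(producing such an `h` from `f ∈ 𝔉*_η(γ)` with `f(1) < −1 ≤ f`, Theorem 9.1 with Theorem 6.4 and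
the measure argument) is the remaining input for `FordMaynardPrimeFreeOfTypeIStar`.

## References

* K. Ford, J. Maynard, *On the theory of prime producing sieves*, arXiv:2407.14368v1 (2024), §6.2
  (proof of Theorem 6.3 (a)) and §9 (proof of Theorem 9.1, the rescaling `w_n = −v_n/z`).
  [FordMaynard2024PrimeSieves]
-/

noncomputable section

open MeasureTheory Finset Real
open Literature.Barriers.Parity

namespace Literature.NumberTheory.Sieve.FordMaynard

/-! ### Type II: every term vanishes -/

/-- If `w(mn) = 0` for every pair in the Type-II summation range, then (II) holds (for `x ≥ 1`).
[cite: FordMaynard2024PrimeSieves, §6.2 ("Therefore, (II) holds trivially")] -/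
theorem typeII_of_forall_eq_zero {w : ℕ → ℝ} {x θ ν B : ℝ} (hx : 1 ≤ x)
    (hzero : ∀ m n : ℕ, 1 ≤ m → (m : ℝ) ≤ x ^ (θ + ν) → (x / 2) ^ θ < m → x / 2 < (m * n : ℝ) →
      (m * n : ℝ) ≤ x → w (m * n) = 0) :
    FordMaynard.TypeII w x θ ν B := by
  intro ξ κ _ _
  have hx0 : 0 < x := by linarith
  rw [Finset.sum_eq_zero]
  · rw [norm_zero]; exact div_nonneg hx0.le (Real.rpow_nonneg (Real.log_nonneg hx) _)
  intro m hm
  rw [Finset.mem_filter, Finset.mem_Icc] at hm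
  refine Finset.sum_eq_zero fun n hn => ?_
  rw [Finset.mem_filter] at hn
  have hmx : (m : ℝ) ≤ x ^ (θ + ν) := by
    have := hm.1.2
    rw [Nat.le_floor_iff (Real.rpow_nonneg hx0.le _)] at this
    exact this
  rw [hzero m n hm.1.1 hmx hm.2 hn.2.1 hn.2.2]
  simp

/-- A sum of logarithms of an enumeration of the prime factors. [folklore] -/
theorem sum_logVec_primeEnum {x : ℝ} {n : ℕ} (hn : Squarefree n) :
    ∑ i, logVec x (primeEnum n) i = Real.log n / Real.log x := by
  unfold logVec
  rw [← Finset.sum_div, sum_log_primeEnum hn]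

/-- **Vanishing of `w_{mn}` in the Type-II range.** If `h` vanishes at vectors with a nonempty
proper subsum in `[θ − ε, θ + ν + ε]` (`0 ≤ θ`, `θ + ν < 1`, `0 < ε ≤ 1`), then for `x` large
(`x ≥ 4`, `2 log 2/log x ≤ ε`, `2 x^{θ+ν} ≤ x`), `w_{mn} = 0` whenever `(x/2)^θ < m ≤ x^{θ+ν}`
and `x/2 < mn ≤ x`: the subsum of `𝐯(mn)` over the primes of `m` is `log m/log(mn) ∈
[θ − ε, θ + ν + ε]`. [cite: FordMaynard2024PrimeSieves, §6.2 (proof of Theorem 6.3 (a))] -/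
theorem wseq_mul_eq_zero_of_typeII_range {h : VecFn} (hsym : h.IsSymmetric) {θ ν ε : ℝ}
    (hθ0 : 0 ≤ θ) (hν0 : 0 ≤ ν) (hε : 0 < ε) (hε1 : ε ≤ 1)
    (hθv : ∀ (k : ℕ) (v : Fin k → ℝ) (B : Finset (Fin k)), B.Nonempty → B ≠ Finset.univ →
      θ - ε ≤ ∑ i ∈ B, v i → ∑ i ∈ B, v i ≤ θ + ν + ε → h k v = 0)
    {x : ℝ} (hx4 : 4 ≤ x) (hlogε : 2 * Real.log 2 / Real.log x ≤ ε) (hxθν : 2 * x ^ (θ + ν) ≤ x)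
    {m n : ℕ} (hm1 : 1 ≤ m) (hmx : (m : ℝ) ≤ x ^ (θ + ν)) (hmθ : (x / 2) ^ θ < m)
    (hmn1 : x / 2 < (m * n : ℝ)) (hmn2 : (m * n : ℝ) ≤ x) : wseq h (m * n) = 0 := by
  classical
  by_contra hne
  have hsq : Squarefree (m * n) := by
    by_contra hsq; exact hne (wseq_of_not_squarefree h hsq)
  obtain ⟨hcop, hmsq, hnsq⟩ := Nat.squarefree_mul_iff.1 hsq
  have hx0 : 0 < x := by linarith
  have hx1 : 1 < x := by linarith
  have hL0 : 0 < Real.log x := Real.log_pos hx1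
  set L := Real.log x with hL
  have hmR : (0 : ℝ) < m := by exact_mod_cast hm1
  -- `m ≥ 2` and `n ≥ 2`
  have hm2 : 2 ≤ m := by
    by_contra hlt
    have hm1' : m = 1 := by omega
    rw [hm1', Nat.cast_one] at hmθ
    have : (1 : ℝ) ≤ (x / 2) ^ θ := Real.one_le_rpow (by linarith) hθ0
    linarith
  have hn0 : n ≠ 0 := by rintro rfl; simp at hmn1; linarith
  have hn2 : 2 ≤ n := by
    by_contra hlt
    have hn1' : n = 1 := by omega
    rw [hn1', Nat.cast_one, mul_one] at hmn1
    linarith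
  have hnR : (0 : ℝ) < n := by exact_mod_cast Nat.pos_of_ne_zero hn0
  -- enumerate the primes of `n`
  set s := n.primeFactors.card with hs
  set q : Fin s → ℕ := primeEnum n with hq
  have hqinj : Function.Injective q := by
    intro i j hij
    have : (n.primeFactors.equivFin.symm i : ℕ) = n.primeFactors.equivFin.symm j := hij
    exact n.primeFactors.equivFin.symm.injective (Subtype.ext this)
  have hqP : ∀ i, (q i).Prime := fun i => Nat.prime_of_mem_primeFactors (n.primeFactors.equivFin.symm i).2
  have hqm : ∀ i, q i ∉ m.primeFactors := by
    intro i hi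
    have hqn : q i ∈ n.primeFactors := (n.primeFactors.equivFin.symm i).2
    exact Finset.disjoint_left.1 hcop.disjoint_primeFactors hi hqn
  have hprod : ∏ i, q i = n := by
    have : ∏ i, q i = ∏ p ∈ n.primeFactors, p := by
      rw [hq]; unfold primeEnum
      rw [Equiv.prod_comp n.primeFactors.equivFin.symm (fun p : ↥n.primeFactors => (p : ℕ))]
      exact Finset.prod_coe_sort n.primeFactors (fun p : ℕ => p)
    rw [this, Nat.prod_primeFactors_of_squarefree hnsq]
  have hw := wseq_mul_prod_eq hsym hx1 hmsq hqinj hqP hqm (x := x)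
  rw [hprod] at hw
  rw [hw] at hne
  -- the subsum over the primes of `m`
  set t := m.primeFactors.card with ht
  set B : Finset (Fin (t + s)) := (Finset.univ : Finset (Fin t)).map (Fin.castAddEmb s) with hB
  have ht1 : 1 ≤ t := by
    rw [ht, Nat.one_le_iff_ne_zero, Ne, Finset.card_eq_zero, Nat.primeFactors_eq_empty]
    omega
  have hs1 : 1 ≤ s := by
    rw [hs, Nat.one_le_iff_ne_zero, Ne, Finset.card_eq_zero, Nat.primeFactors_eq_empty]
    omega
  have hBne : B.Nonempty := by
    rw [hB, Finset.map_nonempty]; exact ⟨⟨0, ht1⟩, Finset.mem_univ _⟩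
  have hBuniv : B ≠ Finset.univ := by
    intro hBu
    have : Fin.natAdd t (⟨0, hs1⟩ : Fin s) ∈ B := by rw [hBu]; exact Finset.mem_univ _
    rw [hB, Finset.mem_map] at this
    obtain ⟨i, -, hi⟩ := this
    have := congrArg Fin.val hi
    simp [Fin.castAddEmb] at this
    omega
  have hsub : ∑ i ∈ B, normVec (uvec x m) (logVec x q) i =
      Real.log m / Real.log ((m * n : ℕ)) := by
    rw [hB, sum_normVec_castAdd, sum_uvec x hmsq, hq, sum_logVec_primeEnum hnsq, ← add_div,
      ← Real.log_mul hmR.ne' hnR.ne', Nat.cast_mul, div_div_div_cancel_right₀ hL0.ne']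
  have hlogmn0 : 0 < Real.log ((m * n : ℕ)) := by
    rw [Nat.cast_mul]; exact Real.log_pos (by nlinarith)
  have hlogmn_ge : L - Real.log 2 < Real.log ((m * n : ℕ)) := by
    rw [Nat.cast_mul, ← Real.log_div hx0.ne' (by norm_num)]
    exact Real.log_lt_log (by positivity) hmn1
  have hlogmn_le : Real.log ((m * n : ℕ)) ≤ L := by
    rw [Nat.cast_mul]; exact Real.log_le_log (by positivity) hmn2
  have hlogm_ge : θ * (L - Real.log 2) < Real.log m := by
    have : Real.log ((x / 2) ^ θ) < Real.log m := Real.log_lt_log (Real.rpow_pos_of_pos (by positivity) θ) hmθ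
    rwa [Real.log_rpow (by positivity), Real.log_div hx0.ne' (by norm_num)] at this
  have hlogm_le : Real.log m ≤ (θ + ν) * L := by
    have := Real.log_le_log hmR hmx
    rwa [Real.log_rpow hx0] at this
  have hl2 : Real.log 2 ≤ ε * L / 2 := by
    rw [div_le_iff₀ hL0] at hlogε; linarith
  have hlog2 : 0 < Real.log 2 := Real.log_pos one_lt_two
  refine hne (hθv _ _ B hBne hBuniv ?_ ?_)
  · rw [hsub, le_div_iff₀ hlogmn0]
    -- `(θ − ε) log(mn) ≤ θ (L − log 2) < log m`
    have h1 : (θ - ε) * Real.log ((m * n : ℕ)) ≤ θ * (L - Real.log 2) := by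
      have hθL : θ * Real.log ((m * n : ℕ)) ≤ θ * L := mul_le_mul_of_nonneg_left hlogmn_le hθ0
      have hεl : ε * (L - Real.log 2) ≤ ε * Real.log ((m * n : ℕ)) := mul_le_mul_of_nonneg_left hlogmn_ge.le hε.le
      have hθ1 : θ * Real.log 2 ≤ 1 * Real.log 2 := by
        refine mul_le_mul_of_nonneg_right ?_ hlog2.le
        -- `θ ≤ θ + ν < 1`... we only know `θ + ν` via `2 x^{θ+ν} ≤ x`; use `θ ≤ 1` from it
        by_contra hθ1
        have : x ^ (1 : ℝ) ≤ x ^ (θ + ν) :=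
          Real.rpow_le_rpow_of_exponent_le hx1.le (by linarith [not_le.1 hθ1])
        rw [Real.rpow_one] at this
        linarith
      nlinarith
    linarith
  · rw [hsub, div_le_iff₀ hlogmn0]
    -- `log m ≤ (θ+ν) L ≤ (θ+ν+ε)(L − log 2) < (θ+ν+ε) log(mn)`
    have hθν1 : θ + ν ≤ 1 := by
      by_contra h1
      have : x ^ (1 : ℝ) ≤ x ^ (θ + ν) := Real.rpow_le_rpow_of_exponent_le hx1.le (by linarith [not_le.1 h1])
      rw [Real.rpow_one] at this
      linarith
    have h1 : (θ + ν) * L ≤ (θ + ν + ε) * (L - Real.log 2) := by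
      have : (θ + ν + ε) * Real.log 2 ≤ 2 * Real.log 2 := by nlinarith
      nlinarith
    have h2 : (θ + ν + ε) * (L - Real.log 2) ≤ (θ + ν + ε) * Real.log ((m * n : ℕ)) :=
      mul_le_mul_of_nonneg_left hlogmn_ge.le (by linarith)
    linarith

/-! ### Type I from the bound at each divisor -/

/-- The inner sums of (I) are differences of two `Vsum`s (or empty). [folklore] -/
theorem abs_inner_le_two_mul {h : VecFn} {x : ℝ} (hx : 0 < x) (m : ℕ) (hm : 1 ≤ m) {E : ℝ}
    (hE : ∀ R : ℕ, (R : ℝ) ≤ x / m → |Vsum h x m R| ≤ E) (a b : ℕ) :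
    |∑ n ∈ (Finset.Icc a b).filter (fun n : ℕ => x / 2 < (m * n : ℝ) ∧ (m * n : ℝ) ≤ x),
        wseq h (m * n)| ≤ 2 * E := by
  classical
  have hmR : (0 : ℝ) < m := by exact_mod_cast hm
  have hE0 : 0 ≤ E := (abs_nonneg _).trans (hE 0 (by simp; positivity))
  set Rx : ℕ := ⌊x / m⌋₊ with hRx
  have hRle : ∀ c : ℕ, ((min c Rx : ℕ) : ℝ) ≤ x / m := fun c =>
    (Nat.cast_le.2 (Nat.min_le_right c Rx)).trans (Nat.floor_le (div_nonneg hx.le hmR.le))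
  -- the sets
  set S : ℕ → Finset ℕ := fun c => (Finset.Icc 1 (min c Rx)).filter (fun r : ℕ => x / 2 < ((m * r : ℕ) : ℝ))
    with hS
  have hVS : ∀ c, Vsum h x m (min c Rx) = ∑ r ∈ S c, wseq h (m * r) := fun c => rfl
  have hmem : ∀ c r, r ∈ S c ↔ (1 ≤ r ∧ r ≤ c ∧ (m * r : ℝ) ≤ x) ∧ x / 2 < (m * r : ℝ) := by
    intro c r
    rw [hS, Finset.mem_filter, Finset.mem_Icc, Nat.cast_mul]
    constructor
    · rintro ⟨⟨h1, h2⟩, h3⟩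
      refine ⟨⟨h1, le_trans h2 (Nat.min_le_left _ _), ?_⟩, h3⟩
      have : (r : ℝ) ≤ x / m := (Nat.cast_le.2 (le_trans h2 (Nat.min_le_right _ _))).trans
        (Nat.floor_le (div_nonneg hx.le hmR.le))
      rw [le_div_iff₀' hmR] at this; exact this
    · rintro ⟨⟨h1, h2, h3⟩, h4⟩
      refine ⟨⟨h1, le_min h2 ?_⟩, h4⟩
      rw [hRx, Nat.le_floor_iff (div_nonneg hx.le hmR.le), le_div_iff₀' hmR]
      exact h3
  set T := (Finset.Icc a b).filter (fun n : ℕ => x / 2 < (m * n : ℝ) ∧ (m * n : ℝ) ≤ x) with hT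
  by_cases hab : a ≤ b + 1
  · -- `T = S b \\ S (a - 1)` and `S (a-1) ⊆ S b`
    have hsub : S (a - 1) ⊆ S b := by
      intro r hr
      rw [hmem] at hr ⊢
      exact ⟨⟨hr.1.1, by omega, hr.1.2.2⟩, hr.2⟩
    have hTeq : T = S b \ S (a - 1) := by
      ext r
      rw [hT, Finset.mem_filter, Finset.mem_Icc, Finset.mem_sdiff, hmem, hmem]
      constructor
      · rintro ⟨⟨h1, h2⟩, h3, h4⟩
        have hr1 : 1 ≤ r := by
          by_contra h0
          have : r = 0 := by omega
          subst this; simp at h3; linarith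
        exact ⟨⟨⟨hr1, h2, h4⟩, h3⟩, fun hh => by omega⟩
      · rintro ⟨⟨⟨h1, h2, h3⟩, h4⟩, h5⟩
        refine ⟨⟨?_, h2⟩, h4, h3⟩
        by_contra hlt
        exact h5 ⟨⟨h1, by omega, h3⟩, h4⟩
    rw [hTeq, Finset.sum_sdiff_eq_sub hsub, ← hVS, ← hVS]
    calc |Vsum h x m (min b Rx) - Vsum h x m (min (a - 1) Rx)|
        ≤ |Vsum h x m (min b Rx)| + |Vsum h x m (min (a - 1) Rx)| := abs_sub _ _
      _ ≤ E + E := add_le_add (hE _ (hRle b)) (hE _ (hRle (a - 1)))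
      _ = 2 * E := by ring
  · have : T = ∅ := by
      rw [hT, Finset.filter_eq_empty_iff]
      intro r hr
      rw [Finset.mem_Icc] at hr
      omega
    rw [this, Finset.sum_empty, abs_zero]
    linarith

/-- Scaling: (I) for `w` implies (I) for `c • w` when `|c| ≤ 1`. [folklore] -/
theorem typeI_smul {w : ℕ → ℝ} {x γ B c : ℝ} (hc : |c| ≤ 1) (h : FordMaynard.TypeI w x γ B) :
    FordMaynard.TypeI (fun n => c * w n) x γ B := by
  intro I
  refine le_trans (Finset.sum_le_sum fun m _ => ?_) (h I)
  rw [← Finset.mul_sum, abs_mul]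
  refine mul_le_mul_of_nonneg_left ?_ (Real.rpow_nonneg (Nat.cast_nonneg _) _)
  calc |c| * |∑ n ∈ (Finset.Icc (I m).1 (I m).2).filter
        (fun n : ℕ => x / 2 < (m * n : ℝ) ∧ (m * n : ℝ) ≤ x), w (m * n)|
      ≤ 1 * |∑ n ∈ (Finset.Icc (I m).1 (I m).2).filter
        (fun n : ℕ => x / 2 < (m * n : ℝ) ∧ (m * n : ℝ) ≤ x), w (m * n)| :=
        mul_le_mul_of_nonneg_right hc (abs_nonneg _)
    _ = _ := one_mul _

/-- **(I) for `w_n = h(𝐯(n)) μ²(n)`** from the bound at each divisor: if for some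
`A ≥ ⌈B⌉ + 2^{⌈B⌉+1} + 1` one has `|Vsum h x m R| ≤ C x/(m (log x)^A)` for all `x ≥ X`,
`1 ≤ m ≤ x^γ`, `R ≤ x/m`, then (I) holds at level `x^γ` with exponent `B` for all large `x`
(summing `τ(m)^B ≤ τ(m)^{⌈B⌉}` against `1/m` with the tree's divisor moment bound).
[cite: FordMaynard2024PrimeSieves, §6.2 ("From this, (I) follows easily, for any B")] -/
theorem exists_typeI_wseq {h : VecFn} {γ B C X : ℝ} (hC : 0 ≤ C) {A : ℕ}
    (hA : ⌈B⌉₊ + 2 ^ (⌈B⌉₊ + 1) + 1 ≤ A)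
    (hV : ∀ x : ℝ, X ≤ x → ∀ m : ℕ, 1 ≤ m → (m : ℝ) ≤ x ^ γ → ∀ R : ℕ, (R : ℝ) ≤ x / m →
      |Vsum h x m R| ≤ C * x / (m * Real.log x ^ A)) (hγ1 : γ ≤ 1) :
    ∃ X' : ℝ, ∀ x : ℝ, X' ≤ x → FordMaynard.TypeI (wseq h) x γ B := by
  classical
  set b := ⌈B⌉₊ with hb
  obtain ⟨Cd, hCd0, hCd⟩ := Literature.NumberTheory.Sieve.exists_sum_sigma_zero_pow_div_le_real b
  refine ⟨max (max X 3) (Real.exp (2 * C * Cd)), fun x hx => ?_⟩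
  have hxX : X ≤ x := le_trans (le_trans (le_max_left _ _) (le_max_left _ _)) hx
  have hx3 : 3 ≤ x := le_trans (le_trans (le_max_right _ _) (le_max_left _ _)) hx
  have hxe : Real.exp (2 * C * Cd) ≤ x := le_trans (le_max_right _ _) hx
  have hx1 : 1 < x := by linarith
  have hx0 : 0 < x := by linarith
  have hL1 : 1 ≤ Real.log x := by
    rw [← Real.log_exp 1]
    exact Real.log_le_log (Real.exp_pos 1) (by linarith [Real.exp_one_lt_d9])
  have hL0 : 0 < Real.log x := by linarith
  set L := Real.log x with hL
  have hCL : 2 * C * Cd ≤ L := by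
    have := Real.log_le_log (Real.exp_pos _) hxe
    rwa [Real.log_exp] at this
  intro I
  -- each inner sum is at most `2 C x/(m L^A)`
  have hinner : ∀ m ∈ Finset.Icc 1 ⌊x ^ γ⌋₊,
      ((m.divisors.card : ℝ) ^ B) *
        |∑ n ∈ (Finset.Icc (I m).1 (I m).2).filter
            (fun n : ℕ => x / 2 < (m * n : ℝ) ∧ (m * n : ℝ) ≤ x), wseq h (m * n)| ≤
        (2 * C * x / L ^ A) * ((ArithmeticFunction.sigma 0 m : ℝ) ^ b / m) := by
    intro m hm
    rw [Finset.mem_Icc] at hm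
    have hmγ : (m : ℝ) ≤ x ^ γ := (Nat.le_floor_iff (Real.rpow_nonneg hx0.le _)).1 hm.2
    have hmR : (0 : ℝ) < m := by exact_mod_cast hm.1
    have hE := fun R hR => hV x hxX m hm.1 hmγ R hR
    have h1 := abs_inner_le_two_mul (h := h) hx0 m hm.1 hE (I m).1 (I m).2
    have hτ1 : (1 : ℝ) ≤ m.divisors.card := by
      exact_mod_cast Finset.card_pos.2 ⟨1, Nat.one_mem_divisors.2 (by omega)⟩
    have hτ : (m.divisors.card : ℝ) ^ B ≤ (ArithmeticFunction.sigma 0 m : ℝ) ^ b := by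
      rw [ArithmeticFunction.sigma_zero_apply, ← Real.rpow_natCast]
      exact Real.rpow_le_rpow_of_exponent_le hτ1 (Nat.le_ceil B)
    calc ((m.divisors.card : ℝ) ^ B) * |∑ n ∈ (Finset.Icc (I m).1 (I m).2).filter
            (fun n : ℕ => x / 2 < (m * n : ℝ) ∧ (m * n : ℝ) ≤ x), wseq h (m * n)|
        ≤ (ArithmeticFunction.sigma 0 m : ℝ) ^ b * (2 * (C * x / (m * L ^ A))) :=
          mul_le_mul hτ h1 (abs_nonneg _) (by positivity)
      _ = (2 * C * x / L ^ A) * ((ArithmeticFunction.sigma 0 m : ℝ) ^ b / m) := by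
          field_simp
  have hsum := hCd x (by linarith)
  have hsub : ∑ m ∈ Finset.Icc 1 ⌊x ^ γ⌋₊, (ArithmeticFunction.sigma 0 m : ℝ) ^ b / m ≤
      ∑ m ∈ Finset.Icc 1 ⌊x⌋₊, (ArithmeticFunction.sigma 0 m : ℝ) ^ b / m := by
    refine Finset.sum_le_sum_of_subset_of_nonneg (Finset.Icc_subset_Icc_right (Nat.floor_le_floor ?_))
      (fun m _ _ => by positivity)
    calc x ^ γ ≤ x ^ (1 : ℝ) := Real.rpow_le_rpow_of_exponent_le hx1.le hγ1
      _ = x := Real.rpow_one x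
  calc ∑ m ∈ Finset.Icc 1 ⌊x ^ γ⌋₊, ((m.divisors.card : ℝ) ^ B) *
        |∑ n ∈ (Finset.Icc (I m).1 (I m).2).filter
            (fun n : ℕ => x / 2 < (m * n : ℝ) ∧ (m * n : ℝ) ≤ x), wseq h (m * n)|
      ≤ ∑ m ∈ Finset.Icc 1 ⌊x ^ γ⌋₊, (2 * C * x / L ^ A) * ((ArithmeticFunction.sigma 0 m : ℝ) ^ b / m) :=
        Finset.sum_le_sum hinner
    _ = (2 * C * x / L ^ A) * ∑ m ∈ Finset.Icc 1 ⌊x ^ γ⌋₊, (ArithmeticFunction.sigma 0 m : ℝ) ^ b / m := by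
        rw [Finset.mul_sum]
    _ ≤ (2 * C * x / L ^ A) * (Cd * L ^ (2 ^ (b + 1))) :=
        mul_le_mul_of_nonneg_left (hsub.trans hsum) (by positivity)
    _ ≤ x / L ^ B := by
        -- `2 C Cd L^{2^{b+1}} / L^A ≤ 1/L^b ≤ 1/L^B`
        have hLb : L ^ B ≤ L ^ (b : ℝ) := Real.rpow_le_rpow_of_exponent_le hL1 (Nat.le_ceil B)
        rw [Real.rpow_natCast] at hLb
        have hLB0 : 0 < L ^ B := Real.rpow_pos_of_pos hL0 B
        have hstep : (2 * C * x / L ^ A) * (Cd * L ^ (2 ^ (b + 1))) ≤ x / L ^ b := by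
          rw [div_mul_eq_mul_div, div_le_div_iff₀ (pow_pos hL0 A) (pow_pos hL0 b)]
          have hApow : L ^ (b + 2 ^ (b + 1) + 1) ≤ L ^ A := pow_le_pow_right₀ hL1 hA
          calc 2 * C * x * (Cd * L ^ (2 ^ (b + 1))) * L ^ b = x * (2 * C * Cd) * L ^ (2 ^ (b + 1) + b) := by ring
            _ ≤ x * L * L ^ (2 ^ (b + 1) + b) := by
                refine mul_le_mul_of_nonneg_right (mul_le_mul_of_nonneg_left hCL hx0.le) (by positivity)
            _ = x * L ^ (b + 2 ^ (b + 1) + 1) := by ring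
            _ ≤ x * L ^ A := mul_le_mul_of_nonneg_left hApow hx0.le
        calc (2 * C * x / L ^ A) * (Cd * L ^ (2 ^ (b + 1))) ≤ x / L ^ b := hstep
          _ ≤ x / L ^ B := div_le_div_of_nonneg_left hx0.le hLB0 hLb

/-! ### Prime-free admissible sequences -/

/-- **Theorem 6.3 (a) in exact form, assembled.** Let `h ∈ 𝒮` be bounded by `H_b`, supported on
vectors with entries `≥ η ∈ (0,1]`, zero on the empty vector and in dimensions `> K_max`,
piecewise Lipschitz in each dimension, satisfying (TypeI-f) with parameter `γ ∈ (0,1)`, vanishing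
at every vector with a nonempty proper subsum in `[γ−ε, γ+ε]` or in `[θ−ε, θ+ν+ε]`
(`0 ≤ θ`, `0 ≤ ν`, `θ + ν < 1`, `0 < ε ≤ 1`), with `z = h(1) < −1` and `z ≤ h(β)` for all `β` of
dimension `≥ 2`. Then for every real `B`, prime-free admissible sequences exist eventually:
`a_n = 1 − w_n/z ∈ [0, 1 + H_b]`, `a_p = 0` on primes, and `a − 1 = −w/z` satisfies (I) at level
`x^γ` and (II) in the range `[θ, θ+ν]` for all large `x`. [cite: FordMaynard2024PrimeSieves, Theorem 6.3 (a) and §9 (proof of Theorem 9.1)] -/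
theorem primeFreeAdmissible_of_vecFn {h : VecFn} (hsym : h.IsSymmetric) {η γ θ ν ε Hb : ℝ}
    (hη : 0 < η) (hη1 : η ≤ 1) (hγ0 : 0 < γ) (hγ1 : γ < 1) (hθ0 : 0 ≤ θ) (hν0 : 0 ≤ ν)
    (hθν : θ + ν < 1) (hε : 0 < ε) (hε1 : ε ≤ 1)
    (hsupp : ∀ (k : ℕ) (v : Fin k → ℝ), h k v ≠ 0 → ∀ i, η ≤ v i)
    (hbdd : ∀ (k : ℕ) (v : Fin k → ℝ), |h k v| ≤ Hb) (hpl : ∀ k, IsPiecewiseLipschitz (h k))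
    (htypeI : TypeIIdentity γ h) {Kmax : ℕ} (hvan : ∀ k, Kmax < k → ∀ v, h k v = 0)
    (h0 : ∀ v, h 0 v = 0)
    (hγv : ∀ (k : ℕ) (v : Fin k → ℝ) (B : Finset (Fin k)), B.Nonempty → B ≠ Finset.univ →
      γ - ε ≤ ∑ i ∈ B, v i → ∑ i ∈ B, v i ≤ γ + ε → h k v = 0)
    (hθv : ∀ (k : ℕ) (v : Fin k → ℝ) (B : Finset (Fin k)), B.Nonempty → B ≠ Finset.univ →
      θ - ε ≤ ∑ i ∈ B, v i → ∑ i ∈ B, v i ≤ θ + ν + ε → h k v = 0)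
    (hz : h 1 (fun _ => 1) < -1) (hlow : ∀ k, 2 ≤ k → ∀ v, h 1 (fun _ => 1) ≤ h k v)
    (B : ℝ) : FordMaynard.PrimeFreeAdmissible γ θ ν B := by
  classical
  set z := h 1 (fun _ => 1) with hzdef
  have hz0 : z < 0 := by linarith
  have hzne : z ≠ 0 := hz0.ne
  have hHb : 0 ≤ Hb := (abs_nonneg _).trans (hbdd 0 fun i => i.elim0)
  -- Type I
  set A : ℕ := ⌈B⌉₊ + 2 ^ (⌈B⌉₊ + 1) + 1 with hA
  obtain ⟨C, hC0, X, hX2, hV⟩ := exists_Vsum_bound hsym hη hη1 hγ0 hγ1 hε hsupp hbdd hpl htypeI hvan hγv A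
  obtain ⟨X₁, hX₁⟩ := exists_typeI_wseq (h := h) (B := B) hC0 le_rfl hV hγ1.le
  -- Type II thresholds
  obtain ⟨X₂, hX₂2, hX₂⟩ := eventually_largeX₂ η (θ + ν) ε hη hθν hε 0
  refine ⟨1 + Hb / (-z), max X₁ X₂, fun x hx => ?_⟩
  have hxX₁ : X₁ ≤ x := le_trans (le_max_left _ _) hx
  have hxX₂ : X₂ ≤ x := le_trans (le_max_right _ _) hx
  obtain ⟨hx4, hlogε, hx1θν, -, -⟩ := hX₂ x hxX₂
  have hx0 : 0 < x := by linarith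
  have hx1 : 1 < x := by linarith
  -- values of `w`
  have h0' : ∀ k, k = 0 → ∀ v, h k v = 0 := by rintro k rfl v; exact h0 v
  have hw : ∀ n, z ≤ wseq h n ∧ |wseq h n| ≤ Hb := by
    intro n
    by_cases hsq : Squarefree n
    · have hbd : |wseq h n| ≤ Hb := by unfold wseq; rw [if_pos hsq]; exact hbdd _ _
      refine ⟨?_, hbd⟩
      rcases Nat.lt_or_ge n.primeFactors.card 2 with hk | hk
      · rcases Nat.lt_or_ge n.primeFactors.card 1 with hk1 | hk1
        · have hc : n.primeFactors.card = 0 := by omega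
          have : wseq h n = 0 := by unfold wseq; rw [if_pos hsq]; exact h0' _ hc _
          rw [this]; exact hz0.le
        · have hc : n.primeFactors.card = 1 := by omega
          obtain ⟨p, hp⟩ := Finset.card_eq_one.1 hc
          have hpP : p.Prime :=
            Nat.prime_of_mem_primeFactors (by rw [hp]; exact Finset.mem_singleton_self p)
          have hn : n = p := by
            have := Nat.prod_primeFactors_of_squarefree hsq
            rw [hp, Finset.prod_singleton] at this
            exact this.symm
          rw [hn, wseq_prime hsym hpP]
      · unfold wseq; rw [if_pos hsq]; exact hlow _ hk _
    · rw [wseq_of_not_squarefree h hsq]; exact ⟨hz0.le, by rw [abs_zero]; exact hHb⟩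
  have hnz : 0 < -z := by linarith
  have ha_eq : ∀ n, 1 - wseq h n / z = 1 + wseq h n / (-z) := by
    intro n; rw [div_neg]; ring
  -- the sequence
  refine ⟨fun n => 1 - wseq h n / z, fun n => ?_, ?_, ?_, ?_⟩
  · show 0 ≤ 1 - wseq h n / z ∧ 1 - wseq h n / z ≤ 1 + Hb / (-z)
    rw [ha_eq]
    constructor
    · have : -1 ≤ wseq h n / (-z) := by
        rw [le_div_iff₀ hnz]; linarith [(hw n).1]
      linarith
    · have : wseq h n / (-z) ≤ Hb / (-z) :=
        div_le_div_of_nonneg_right ((le_abs_self _).trans (hw n).2) hnz.le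
      linarith
  · -- Type I for `a − 1 = (−1/z) w`
    have hfun : (fun n => 1 - wseq h n / z - 1) = fun n => (-1 / z) * wseq h n := by
      funext n; field_simp; ring
    show FordMaynard.TypeI (fun n => 1 - wseq h n / z - 1) x γ B
    rw [hfun]
    refine typeI_smul ?_ (hX₁ x hxX₁)
    rw [abs_div, abs_neg, abs_one, div_le_one (abs_pos.2 hzne), abs_of_neg hz0]
    linarith
  · -- Type II: every term vanishes
    show FordMaynard.TypeII (fun n => 1 - wseq h n / z - 1) x θ ν B
    refine typeII_of_forall_eq_zero hx1.le fun m n hm1 hmx hmθ hmn1 hmn2 => ?_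
    have hxθν : 2 * x ^ (θ + ν) ≤ x := by
      have hsplit : x ^ (θ + ν) * x ^ (1 - (θ + ν)) = x := by
        rw [← Real.rpow_add hx0, add_sub_cancel, Real.rpow_one]
      calc 2 * x ^ (θ + ν) = x ^ (θ + ν) * 2 := mul_comm _ _
        _ ≤ x ^ (θ + ν) * x ^ (1 - (θ + ν)) := mul_le_mul_of_nonneg_left hx1θν (Real.rpow_nonneg hx0.le _)
        _ = x := hsplit
    have := wseq_mul_eq_zero_of_typeII_range hsym hθ0 hν0 hε hε1 hθv hx4 hlogε hxθν hm1 hmx hmθ hmn1 hmn2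
    show 1 - wseq h (m * n) / z - 1 = 0
    rw [this]; ring
  · -- primes
    intro p hp _ _
    show 1 - wseq h p / z = 0
    rw [wseq_prime hsym hp, ← hzdef, div_self hzne, sub_self]

end Literature.NumberTheory.Sieve.FordMaynard
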